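import Mathlib
import HarnessLib
import HarnessLib.Audit
import Summits.CriticalPhenomena.Statement
import Literature.Probability.LatticeModels.IsoradialPercolation

/-!
Route: PercLongRangeCatalyst

DORMANT since 2026-08-29T23:07:22Z (reconciler: no traction for 5 d (last activity statement-closed at 2026-08-24T22:19:58Z); parked, not closed — `ledger route dormant route-CriticalPhenomena-PercLongRangeCatalyst --off` to reactivate) — unstaffed, not closed; items shared with open routes are served there. `ledger route dormant <id> --off` reactivates.

# Route PercLongRangeCatalyst — irrelevant long-range catalyst — λ-uniform Hutchcroft bounds for the
mixed kernel 1(nn)+λ|x|^(-3-α) on ℤ³, then λ→0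

It suffices to show X = U ∧ S (card
CriticalPhenomena/PercolationContinuityZ3/irrelevant-long-range-catalyst). The CATALYST FAMILY is
long-range percolation on ℤ³ in Hutchcroft's parametrisation with the mixed kernel J_{λ,α}(x,y) =
1{x∼y} + λ·‖x−y‖_∞^{−(3+α)}: every pair
{x,y} is open independently with probability 1 − exp(−b·J_{λ,α}(x,y)) (Lean: `prodBernoulli` on
`Sym2 (Site 3)` with these weights; at
λ = 0 it is nearest-neighbour bond percolation at p = 1 − e^{−b}). For every λ > 0 Hutchcroft2022
(Thm 1.1, Cor 1.4, hypothesis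
J ≥ c‖x−y‖^{−d−α} with c = λ, 0 < α < d = 3) gives continuity and critical bounds with constants
A/(λβ_c), A/(λβ_c)^{3/(6−α)}.
U (UniformCatalystVolumeTail, crux r2): for some α ∈ (0,3), a > 0, C, uniformly over λ ∈ (0,1] and
all non-percolating (b,λ):
P_{b,λ}(|K(0)| ≥ n) ≤ C n^{−a} for all n ≥ 1 — the λ-UNIFORM form of Cor 1.4. S
(SubcritCatalystStability, support): every subcritical
nearest-neighbour density p < p_c(ℤ³) is dominated by some non-percolating catalyst model (b,λ) with
λ > 0 (removal of the catalyst costs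
nothing below p_c). Then X → θ(p_c) = 0: monotone coupling gives P_p(|C(0)| ≥ n) ≤ C n^{−a} for all
p < p_c, continuity of the local
event in p carries it to p_c, and θ(p_c) ≤ inf_n P_{p_c}(|C| ≥ n) = 0. The card's two-point form
(crux r3, Σ_{Λ_r} P_{b,λ}(0↔x) ≤ C r^α
uniformly) is filed as the stronger alternative engine; with S it proves
PercTwoPointDecay.SubcritBallAverageDecay with a = 3 − α.
Lean: `(∃ α a C : ℝ, 0 < α ∧ α < 3 ∧ 0 < a ∧ ∀ l : ℝ, 0 < l → l ≤ 1 → ∀ b : ℝ, 0 < b →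
(Literature.Probability.LatticeModels.prodBernoulli (fun e : Sym2
(Literature.Probability.LatticeModels.Site 3) => Set.projIcc (0:ℝ) 1 zero_le_one (1 - Real.exp (-(b
* ((if e ∈ (Literature.Probability.LatticeModels.zdGraph 3).edgeSet then (1:ℝ) else 0) + l *
(Sym2.lift ⟨fun x y : Literature.Probability.LatticeModels.Site 3 => (dist x y : ℝ), fun x y =>
dist_comm x y⟩ e) ^ (-(3 + α)))))))).real (Literature.Probability.Percolation.percolatesAt (0 :
Literature.Probability.LatticeModels.Site 3)) = 0 → ∀ n : ℕ, 1 ≤ n →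
(Literature.Probability.LatticeModels.prodBernoulli (fun e : Sym2
(Literature.Probability.LatticeModels.Site 3) => Set.projIcc (0:ℝ) 1 zero_le_one (1 - Real.exp (-(b
* ((if e ∈ (Literature.Probability.LatticeModels.zdGraph 3).edgeSet then (1:ℝ) else 0) + l *
(Sym2.lift ⟨fun x y : Literature.Probability.LatticeModels.Site 3 => (dist x y : ℝ), fun x y =>
dist_comm x y⟩ e) ^ (-(3 + α)))))))).real ({ω : Literature.Probability.Percolation.BondConfig
(Literature.Probability.LatticeModels.Site 3) | ((n : ℕ) : ℕ∞) ≤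
(Literature.Probability.Percolation.openCluster ω (0 : Literature.Probability.LatticeModels.Site
3)).encard}) ≤ C * (n : ℝ) ^ (-a)) ∧ (∀ α : ℝ, 0 < α → ∀ p : unitInterval, (p : ℝ) <
Literature.Probability.Percolation.criticalProb (Literature.Probability.LatticeModels.zdGraph 3) (0
: Literature.Probability.LatticeModels.Site 3) → ∃ b l : ℝ, 0 < b ∧ 0 < l ∧ l ≤ 1 ∧ (p : ℝ) ≤ 1 -
Real.exp (-b) ∧ (Literature.Probability.LatticeModels.prodBernoulli (fun e : Sym2
(Literature.Probability.LatticeModels.Site 3) => Set.projIcc (0:ℝ) 1 zero_le_one (1 - Real.exp (-(b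
* ((if e ∈ (Literature.Probability.LatticeModels.zdGraph 3).edgeSet then (1:ℝ) else 0) + l *
(Sym2.lift ⟨fun x y : Literature.Probability.LatticeModels.Site 3 => (dist x y : ℝ), fun x y =>
dist_comm x y⟩ e) ^ (-(3 + α)))))))).real (Literature.Probability.Percolation.percolatesAt (0 :
Literature.Probability.LatticeModels.Site 3)) = 0)`

## Assembly
Standard reductions, all inputs proved in the tree: fix p < p_c(ℤ³) (p_c > 0: criticalProb_zd_pos);
S gives a non-percolating catalyst
model (b,λ) dominating n.n.-p edgewise; U gives P_{b,λ}(|K(0)| ≥ n) ≤ C n^{−a}; {|C(0)| ≥ n}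
(written inline as {ω | n ≤ |C_ω(0)|.encard}; = clusterSizeGe 0 n of
MeanFieldBetaFromGamma by Iff.rfl — kept out of the route's imports to keep its cone fact-free) is
increasing and measurable, so prodBernoulli_real_mono_of_isUpperSet (+ bondPercolation (zdGraph 3) p
= prodBernoulli of the indicator weights,
prodBernoulli_indicator_holds) gives P_p(|C(0)| ≥ n) ≤ C n^{−a} for every p < p_c; the event is
determined by the edges of box 3 n, so
p ↦ P_p(|C(0)| ≥ n) is continuous (continuous_bondPercolation_real_of_determinedBy) and the bound
holds at p_c = criticalProbI 3 (closure
of Iio, as in tau_criticalProbI_le_of_forall_lt); finally θ(p_c) ≤ P_{p_c}(|C(0)| ≥ n)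
(percolatesAt_subset_clusterSizeGe, after rewriting the inline event as clusterSizeGe 0 n) ≤ C
n^{−a} → 0,
i.e. PercolationContinuity 3 = PercolationContinuityZ3.

Rationale: WHY THIS LINE. Deform nearest-neighbour percolation on ℤ³ INSIDE its own universality class to
models where continuity and a power-law two-point/volume
bound are THEOREMS (Berger2002; Hutchcroft2022 Thm 1.1, Cor 1.4; Hutchcroft2021), then switch the
deformation off: in the RG-irrelevant
window α > α_c = 2 − η_SR ≈ 2.05 (Sak1973; BrezinParisiRiccitersenghi2014; BehanEtAl2017;
Hutchcroft2025 p.6, (II.1.4)) the long edges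
change no exponent, β_c(λ) ↑ β_c(0), and any λ-UNIFORM form of Hutchcroft's bounds passes to λ = 0
by monotone coupling + continuity of
local events (all glue already proved in the tree: prodBernoulli_real_mono_of_isUpperSet,
continuous_bondPercolation_real_of_determinedBy,
tau_criticalProbI_le_of_forall_lt, theta_eq_zero_of_ballAverage_tendsto_zero). Imported area:
Hutchcroft's hierarchical
runaway-observable renormalisation (universal tightness of |K_max|, ancestrally good blocks,
sharpness as the closing contradiction), a
d ≤ 6 technology never run on a mixed kernel; it replaces the reflection-positivity / lace /
Simon–Lieb inputs of PercTwoPointDecay and the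
box-crossing inputs of PercAnnulusCrossing / PercFiniteBoxLRO. Honest caveat found while planning
(recorded as the why-might-fail of both
cruxes): for λ ≤ 1 in the window the catalyst is subdominant at EVERY scale ≥ 1, and in
Hutchcroft2022 §2 (Lemma 2.6) the constant
c = λ enters exactly through the gluing of sibling clusters by the parent's long edges while all
n.n. edges are revealed at level 0 — so
uniformity is a nearest-neighbour gluing statement at β < β_c(λ), of the same strength as
PercTwoPointDecay's r2; the line is a new
ARCHITECTURE for that statement (two handles: β < β_c(λ) so χ < ∞ is available, and for each λ > 0
everything is a theorem), not a way
around it. Negatives index: one refuted SAW statement (stmt-CriticalPhenomena-0772), unrelated.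

RANKED CRUXES. #2 UniformCatalystVolumeTail (crux) — λ-uniform critical volume tail for the catalyst
family (card item r2 in its weakest sufficient form): there are α ∈ (0,3), a > 0 and C such that for
all λ ∈ (0,1], all b > 0 with P_{b,λ}(|K(0)| = ∞) = 0, and all n ≥ 1, P_{b,λ}(|K(0)| ≥ n) ≤
C·n^{−a}. For each fixed λ this is Hutchcroft2022 Cor 1.4 with C = A(3,α)/(λβ_c(λ))^{3/(6−α)}, a =
(3−α)/6 (the event is increasing, so b < β_c(λ) is covered); the content is uniformity as λ → 0,
where the closure of the non-percolating region reaches the n.n. critical point (numerically this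
forces a ≤ 1/δ_SR ≈ 0.19). [difficulty: open-problem] (why it might fail: For λ≤1 in the window the
LR edges are subdominant at every scale (coupling λL^(−(α−α_c)n)); Hutchcroft2022 Lemma 2.6 glues
sibling clusters ONLY with parent LR edges of strength c=λ, so A/(λβ) is intrinsic: uniformity needs
n.n. gluing at β<β_c(λ) — n.n.-hard.) [Hutchcroft2022, Hutchcroft2021, Hutchcroft2025, Sak1973,
HeydenreichVanDerHofstad2017]
#3 UniformCatalystTwoPoint (crux) — λ-uniform ball-summed critical two-point bound (card item r2
verbatim, Hutchcroft2022 Thm 1.1 shape): there are α ∈ (0,3) and C such that for all λ ∈ (0,1], all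
non-percolating b > 0 and all r ≥ 1, Σ_{x∈Λ_r} P_{b,λ}(0 ↔ x) ≤ C·r^α (Λ_r = box 3 r = [−r,r]³). For
fixed λ this is Thm 1.1 with C = (2r+1)³r^{−3}·A(3,α)/(λβ_c(λ)). Physically true exactly in the
irrelevance window α ≥ α_c = 2 − η_SR ≈ 2.05 (the λ → 0 corner forces Σ_{Λ_r}τ_{p_c} ≈ r^{2.05} ≤
Cr^α), so the prover's α lives in [2.05, 3). Stronger alternative engine: with
SubcritCatalystStability it yields PercTwoPointDecay.SubcritBallAverageDecay
(stmt-CriticalPhenomena-0835) with a = 3 − α (support CatalystToSubcritBallDecay). [difficulty: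
open-problem] (why it might fail: Same n.n.-hardness as r2, plus a sharp window: for α<α_c≈2.05 it
is physically false (critical ball sums →r^2.05 as λ→0), rigorously false for α<1 (Σ_Λr τ_pc ≥ cr,
DuminilCopin2019 §3); and r3+S ⇒ PercTwoPointDecay.r2 (a=3−α), itself ⇔ that route's target.)
[Hutchcroft2022, Hutchcroft2025, BrezinParisiRiccitersenghi2014, BehanEtAl2017, DuminilCopin2019]
#9 SubcritCatalystStability (support) — removal of the catalyst is free below p_c: for every α > 0
and every p < p_c(ℤ³) there are b > 0 and λ ∈ (0,1] with p ≤ 1 − e^{−b} (so n.n.-p is dominated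
edgewise by the catalyst model, whose n.n. edges have weight 1 − e^{−b(1+λ)}) and P_{b,λ}(|K(0)| =
∞) = 0. Proof sketch (Aizenman–Newman cluster-of-clusters / BK): χ_{b,λ} ≤ Σ_k
χ_nn(p')^{k+1}(bλK_α)^k < ∞ once bλK_α χ_nn(p') < 1, where p' = 1 − e^{−b(1+λ)} < p_c for λ small,
K_α = Σ_{y≠0}‖y‖_∞^{−3−α} < ∞, χ_nn(p') < ∞ by sharpness (SharpnessDCT / AizenmanBarsky1987); χ < ∞
⇒ θ = 0. Needs BK (vandenBergKestenJAP1985; BKFinitary.lean) for prodBernoulli on a countable edge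
set via finite-volume approximation. [difficulty: M] [AizenmanNewman1984, AizenmanBarsky1987,
DuminilCopinTassionCMP2016, vandenBergKestenJAP1985, GrimmettPercolation1999]
#9 CatalystToSubcritBallDecay (support) — bridge to route PercTwoPointDecay: UniformCatalystTwoPoint
→ SubcritCatalystStability → SubcritBallAverageDecay (the signature of stmt-CriticalPhenomena-0835,
with a = 3 − α): for p < p_c pick (b,λ) from S, compare edge weights (on n.n. edges 1 − e^{−b(1+λ)}
≥ 1 − e^{−b} ≥ p, elsewhere ≥ 0; bondPercolation = prodBernoulli of the indicator weights,
prodBernoulli_indicator_holds) and apply prodBernoulli_real_mono_of_isUpperSet to the increasing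
events {0 ↔ x}; R^α = R^{3−(3−α)}. [difficulty: provable-now] [GrimmettPercolation1999,
Hutchcroft2022]

TWO-LAYER PLAN. Foreseen glued splits once a crux moves (none filed now): UniformCatalystVolumeTail
⇐ UniformRunawayLemma → UniformTightnessTransfer →
UniformCatalystVolumeTail, where UniformRunawayLemma is Hutchcroft2022 Lemma 2.6 / Prop 2.4 with a
λ-FREE threshold
(M_B² ≥ (A/b)L^{(3+α)n} ⇒ M_{σ(B)} ≥ L^{(3+α)/2}M_B for good blocks, the gluing now by n.n. edges
held back to the level where their
endpoints first share a block) and UniformTightnessTransfer is the universal-tightness passage from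
M_B bounds to the volume tail
(Hutchcroft2021); UniformCatalystTwoPoint ⇐ UniformCatalystVolumeTail-type bound on Σ_{x,y∈B}P(x↔y
in η_B) (Prop 2.7 uniform) → full-space
passage (§2.4) → UniformCatalystTwoPoint. A regime split in α (α near 3, where the runaway
hypothesis means nearly volume-filling
clusters |K_max ∩ B| ≥ L^{(3−δ)n}, vs α near α_c) is the other candidate.

KILL CRITERIA. (i) A proof (refuter) that UniformCatalystVolumeTail or UniformCatalystTwoPoint is
EQUIVALENT, up to glue proved in the tree, to
PercTwoPointDecay's r2/target or to the conjunct itself ⇒ the line is a reformulation: close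
`superseded --by route-CriticalPhenomena-PercTwoPointDecay`
and record the catalyst family as an engine note there. (ii) ¬UniformCatalystTwoPoint for every α ∈
[2.05,3) (e.g. a rigorous lower bound
Σ_{Λ_r}P_{β_c(λ),λ}(0↔x) ≥ cλ^{−s}r^α on a window of r) refutes r3 only — drop r3, keep r2. (iii)
¬UniformCatalystVolumeTail (a λ-dependent
lower bound on the critical volume tail amplitude that diverges as λ → 0) closes the route
`refuted:UniformCatalystVolumeTail` without
touching the conjunct. (iv) SubcritCatalystStability refuted would be a sensation (a summable
perturbation shifting p_c of a sharp
subcritical phase discontinuously) — close and hand the witness to the barrier catalogue. (v)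
PercTwoPointDecay.SubcritBallAverageDecay or
the conjunct proved elsewhere moots the route.

NOT DECOMPOSED YET. The λ-free runaway lemma and the redesign of Hutchcroft's decomposition so that
n.n. edges between sibling blocks are revealed at the
parent level (layer-2 children of r2); the universal-tightness transfer; the small-b regime (b → 0,
trivially subcritical, to be split off
with a branching-process comparison uniform in λ); the full-space passage §2.4 for r3; the choice of
α (prover's: α close to 3 makes the
runaway hypothesis 'nearly volume-filling clusters', α close to α_c makes r^α nearly sharp); the
quantitative form of S (linear critical
shift β_c(0) − β_c(λ) ≤ κλ, expected but not needed); a Literature definition of kernel percolation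
on ℤ^d and Hutchcroft2022 Thm 1.1 /
Cor 1.4 as named facts (requested below; the statements inline the model meanwhile).

CHEAPEST FALSIFIER. Theory, one page: write Hutchcroft2022 Lemma 2.6 for the mixed kernel and
confirm that c = λ is the ONLY gluing input (done while planning:
it is — η_B contains ω_R ⊇ all n.n. edges, so two distinct clusters of η_B are separated by CLOSED
n.n. edges and the parent step can
glue them only with ω_{σ(B)}, of strength c = λ); hence any uniform proof must change the
decomposition — if a refuter shows that no
reassignment of n.n. edges to levels yields a size-only gluing bound, r2's foreseen split is dead
and the route should go dormant.
Numerics (kit, ~CPU-days, informative not decisive since the statements are physically true in the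
window): Monte-Carlo the catalyst
model at α = 2.5, λ ∈ {1, 0.3, 0.1, 0.03}, locate β_c(λ) by wrapping probabilities on L ≤ 64 tori,
and fit the amplitudes of
P(|K| ≥ n) and Σ_{Λ_r}τ at criticality: amplitudes growing like λ^{−1} down to the lattice scale
would refute r2/r3 outright.

NUMBERS. d = 3 n.n. percolation: p_c(bond) ≈ 0.2488, η_SR = −0.046(8) so α_c = 2 − η_SR ≈ 2.05,
1/δ_SR ≈ 0.19, d_f ≈ 2.52 (HeydenreichVanDerHofstad2017;
BottcherHerrmann2021 as quoted in Literature.Barriers.CriticalPhenomena.GaussianDominationRoute).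
Hutchcroft2022: A(d,α) ~ C^{(d+α)/(d−α)},
C ~ 10^50 (Remark 1.2); Cor 1.4 exponent (3−α)/6 ≤ 0.158 in the window; effective LR coupling at
scale L^n: λL^{−(α−α_c)n} (irrelevant for
α > α_c). Items at open: 5 (2 crux, 2 support, 1 assembly).

DEFINITION REQUESTS. (1) `kernelPercolation (d : ℕ) (J : Site d → ℝ) (b : ℝ) : Measure (BondConfig
(Site d))` — long-range percolation on ℤ^d with
translation-invariant kernel, P({x,y} open) = 1 − exp(−b J(y−x)) (Hutchcroft2022 §1), topic
Literature/Probability/Percolation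
(Literature has the ℤ case only: lrMeasure / longRangePercolation); the route's statements inline
the d = 3 mixed kernel via prodBernoulli
meanwhile. (2) cite facts: Hutchcroft2022 Thm 1.1 and Cor 1.4 for kernels J ≥ c‖x−y‖^{−d−α} on ℤ^d
(constants A/(cβ_c),
A/(cβ_c)^{d/(2d−α)}), and Berger2002 continuity (θ(β_c) = 0 for 0 < α < d) — hypotheses for the
per-λ sanity checks, not for the cruxes.

Novelty: Searches (2026-08-15): lit read arXiv:2202.07634 pp.3–10 (Thm 1.1, Rem 1.2, Cor 1.4, 'About the
proof', §2.1–2.3: where c enters);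
lit read arXiv:2508.18808 --grep crossover/alpha_c (p.6 (II.1.4) and 'out of reach … very strong
forms of universality for short-range
models'; p.11 Rem II.1.6); lit frontier CriticalPhenomena --since 2021 (30 rows; nearest:
arXiv:2606.11503 'Percolation on hierarchical
lattices', arXiv:2605.30299 reversed Simon–Lieb d>6); lit galaxy search "long-range percolation"
--star pdf (25 hits; arXiv:2502.12104 Liu,
high-d LR models have RW correlations — d > d_c only); lit galaxy search "crossover from long-range
to short-range" --star all (0 relevant);
lit search local index: daemon reset x3; --source arxiv/s2/openalex: HTTP 429; zbmath: 1 irrelevant.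
Card's refuter audit (2026-08-15)
additionally covered zbMATH 'long-range percolation crossover short-range' (BPR-T 2014, Hutchcroft
I–III) and math-ph/0605047 (mixed
models, subcritical only).
Nearest prior art found: Hutchcroft2022 (doi:10.1063/5.0088450) Thm 1.1 / Cor 1.4 — covers every λ >
0 member of the family with constants
∝ 1/λ; Hutchcroft2025 (arXiv:2508.18808) p.6 — α_c = 2 − η_SR 'out of reach', Rem II.1.6;
DuminilCopinSidoraviciusTassion2016 Prop 3
(Literature.Barriers.CriticalPhenomena.SlabLimitUniformControl) — the same 'uniform control along an
approximating solved family' pattern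
for slabs; physics crossover Sak1973, BrezinParisiRiccitersenghi2014, BehanEtAl2017,
LuijtenBlote2002.
Delta: th  [refs: 10.1063/5.0088450, 2202.07634, 2508.18808, 2606.11503, 2605.30299, 2502.12104, doi:10.1063/5.0088450, Hutchcroft2022, Hutchcroft2025, DuminilCopinSidoraviciusTassion2016, Sak1973, BrezinParisiRiccitersenghi2014, BehanEtAl2017, LuijtenBlote2002]

Barriers (technique_class: long-range-catalyst lambda-uniformity runaway-observable): - technique_class: long-range-catalyst lambda-uniformity runaway-observable
- Literature.Barriers.CriticalPhenomena.SlabLimitUniformControl: NOT evaded — this route is the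
mirror image of DST2016 Prop 3 (uniform control along slabs k→∞ from the supercritical side; here
along catalysts λ→0 from the subcritical side) and inherits its verdict 'roughly of the same
difficulty as attacking the problem directly'; the bet, in DST's own words, is that 'a suitable
renormalization argument enables one to prove' the uniform bound, and the catalyst family, unlike
slabs (quasi-planar, other universality class, no renormalisation available), stays in class and
comes with Hutchcroft's renormalisation for every λ>0.
- Literature.Barriers.CriticalPhenomena.SprinklingRenormalisation: the 'extra money' here is λ, not
η in p; the whole crux is to make the conclusion uniform as the money is withdrawn, so the barrier's
lesson (η>0 vital) reappears verbatim as the why-might-fail of r2/r3 (A/(λβ) intrinsic to Lemma 2.6)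
— conceded, not evaded.
- Literature.Barriers.CriticalPhenomena.GaussianDominationRoute: output side evaded as in
PercTwoPointDecay (r3 asks for r^α with α ≥ 2.05, i.e. a = 3−α ≤ 0.95, inside the η<0-admissible
window; r2 asks only a volume-tail exponent a>0); input side genuinely different (no reflection
positivity, no infrared bound: non-perturbative hierarchical induction).
- Literature.Barriers.CriticalPhenomena.LaceExpansionHighDimension: not triggered — no mean-field
output (a<1

History (route lifecycle, newest last):
- 2026-08-15T16:13:50Z · rev 1: restated UniformCatalystVolumeTail (stmt-CriticalPhenomena-4822) — route-repair (rbadge g4): deciding theorem closes : UniformCatalystVolumeTail → SubcritCatalystStability → Assembly → PercolationContinuityZ3 (native audit ok); (planner-rbadge-CriticalPhenomena-PercLongRange-3094749d-g4-0)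
- 2026-08-22T16:41:30Z · DORMANT — reconciler: no traction for 5.5 d (last activity item-evidence-added at 2026-08-17T04:18:16Z); parked, not closed — `ledger route dormant route-CriticalPhenomen (operator:999:3013260)
- 2026-08-23T15:02:11Z · REACTIVATED — reconciler: reactivated — activity item-proof-filed at 2026-08-23T12:29:17Z after parking at 2026-08-22T16:41:30Z (operator:999:2207537)
- 2026-08-29T23:07:22Z · DORMANT — reconciler: no traction for 5 d (last activity statement-closed at 2026-08-24T22:19:58Z); parked, not closed — `ledger route dormant route-CriticalPhenomena-Per (operator:999:375004)

sub-problem: PercolationContinuityZ3 · status: dormant · opened planner-plancard-CriticalPhenomena-Percolatio-bd092e61-0 2026-08-15T11:35:12Z · rev 2 · ledger route-CriticalPhenomena-PercLongRangeCatalyst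
GENERATED by the gate from the ledger (D-0016/17). Provers cite these decls: `theorem foo : Summit.CriticalPhenomena.PercolationContinuityZ3.Theses.PercLongRangeCatalyst.<Decl> := …` in Summits/CriticalPhenomena/PercolationContinuityZ3/Theorems/<Name>.lean.
-/

namespace Summit.CriticalPhenomena.PercolationContinuityZ3.Theses.PercLongRangeCatalyst

open scoped BigOperators Topology Manifold Classical MeasureTheory ProbabilityTheory Matrix InnerProductSpace ComplexConjugate ContinuousMap
open Filter Set Function TopologicalSpace MeasureTheory

attribute [summit_statement] _root_.PercolationContinuityZ3

-- earlier UniformCatalystVolumeTail (stmt-CriticalPhenomena-4822, replaced 2026-08-15T16:13:50Z -> stmt-CriticalPhenomena-10383): retired by None — ∃ α a C : ℝ, 0 < α ∧ α < 3 ∧ 0 < a ∧ ∀ l : ℝ, 0 < l → l ≤ 1 → ∀ b : ℝ, 0 < b → (Literature.Probability.LatticeModels.prodBernoulli (fun e : Sym2 (Literature.Probability.LatticeModels.Site 3) => Set.projIcc (0:ℝ) 1 zero_le_one (1 - Real.exp (-(b * ((if e 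
/-- item stmt-CriticalPhenomena-10383 · crux · rank 2 · open · by planner
why it might fail: λ→0 uniformity is n.n.-hard: Hutchcroft2022 Lem 2.6 glues sibling clusters only by parent LR edges of strength c=λ, so Cor 1.4's constant A/(λβ_c)^{3/(6−α)} is intrinsic to the method; and U+S ⇒ P_{p_c}(|C|≥n)≤Cn^{−a} on ℤ³, for which no engine exists (Hutchcroft2025 p.6: SR endpoint out of reach).
sources: Hutchcroft2022, Hutchcroft2021, Hutchcroft2025, Sak1973, HeydenreichVanDerHofstad2017
[crux] λ-uniform critical volume tail for the catalyst family (card item r2 in its weakest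
sufficient form): there are α ∈ (0,3), a > 0 and C such that for all λ ∈ (0,1], all b > 0 with
P_{b,λ}(|K(0)| = ∞) = 0, and all n ≥ 1, P_{b,λ}(|K(0)| ≥ n) ≤ C·n^{−a}. For each fixed λ this is
Hutchcroft2022 Cor 1.4 with C = A(3,α)/(λβ_c(λ))^{3/(6−α)}, a = (3−α)/6 (the event is increasing, so
b < β_c(λ) is covered); the content is uniformity as λ → 0, where the closure of the non-percolating
region reaches the n.n. critical point (numerically this forces a ≤ 1/δ_SR ≈ 0.19). The event
{|K(0)| ≥ n} is written inline as {ω | (n : ℕ∞) ≤ (openCluster ω 0).encard} (= clusterSizeGe 0 n of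
Literature.Probability.Percolation.MeanFieldBetaFromGamma by Iff.rfl; inlined so the route file does
not import that module and its 18 unproved facts). [difficulty: open-problem] -/
@[route_item "route-CriticalPhenomena-PercLongRangeCatalyst"]
def UniformCatalystVolumeTail : Prop :=
  ∃ α a C : ℝ, 0 < α ∧ α < 3 ∧ 0 < a ∧ ∀ l : ℝ, 0 < l → l ≤ 1 → ∀ b : ℝ, 0 < b → (Literature.Probability.LatticeModels.prodBernoulli (fun e : Sym2 (Literature.Probability.LatticeModels.Site 3) => Set.projIcc (0:ℝ) 1 zero_le_one (1 - Real.exp (-(b * ((if e ∈ (Literature.Probability.LatticeModels.zdGraph 3).edgeSet then (1:ℝ) else 0) + l * (Sym2.lift ⟨fun x y : Literature.Probability.LatticeModels.Site 3 => (dist x y : ℝ), fun x y => dist_comm x y⟩ e) ^ (-(3 + α)))))))).real (Literature.Probability.Percolation.percolatesAt (0 : Literature.Probability.LatticeModels.Site 3)) = 0 → ∀ n : ℕ, 1 ≤ n → (Literature.Probability.LatticeModels.prodBernoulli (fun e : Sym2 (Literature.Probability.LatticeModels.Site 3) => Set.projIcc (0:ℝ) 1 zero_le_one (1 - Real.exp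 (-(b * ((if e ∈ (Literature.Probability.LatticeModels.zdGraph 3).edgeSet then (1:ℝ) else 0) + l * (Sym2.lift ⟨fun x y : Literature.Probability.LatticeModels.Site 3 => (dist x y : ℝ), fun x y => dist_comm x y⟩ e) ^ (-(3 + α)))))))).real ({ω : Literature.Probability.Percolation.BondConfig (Literature.Probability.LatticeModels.Site 3) | ((n : ℕ) : ℕ∞) ≤ (Literature.Probability.Percolation.openCluster ω (0 : Literature.Probability.LatticeModels.Site 3)).encard}) ≤ C * (n : ℝ) ^ (-a)

/-- item stmt-CriticalPhenomena-4823 · aside · rank 3 · open · by planner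
why it might fail: Sharp window + n.n.-hardness: r3+S ⇒ Σ_{Λ_r}τ_{p_c}≤Cr^α on ℤ³, so α<1 is refuted by φ_{p_c}(Λ_n)≥1 ⇒ Σ_{Λ_r}τ_{p_c}≥r/(3p_c) (DuminilCopin2019 Rem 2.7; DCT2016); α<α_c=2−η_SR≈2.05 is physically false (Hutchcroft2025 (II.1.4)); α∈[α_c,3) is Sak-crossover universality, 'out of reach' (ibid. p.6).
sources: Hutchcroft2022, Hutchcroft2025, BrezinParisiRiccitersenghi2014, BehanEtAl2017, DuminilCopin2019, DuminilCopinTassionCMP2016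
[crux] λ-uniform ball-summed critical two-point bound (card item r2 verbatim, Hutchcroft2022 Thm 1.1
shape): there are α ∈ (0,3) and C such that for all λ ∈ (0,1], all non-percolating b > 0 and all r ≥
1, Σ_{x∈Λ_r} P_{b,λ}(0 ↔ x) ≤ C·r^α (Λ_r = box 3 r = [−r,r]³). For fixed λ this is Thm 1.1 with C =
(2r+1)³r^{−3}·A(3,α)/(λβ_c(λ)). Physically true exactly in the irrelevance window α ≥ α_c = 2 − η_SR
≈ 2.05 (the λ → 0 corner forces Σ_{Λ_r}τ_{p_c} ≈ r^{2.05} ≤ Cr^α), so the prover's α lives in [2.05,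
3). Stronger alternative engine: with SubcritCatalystStability it yields
PercTwoPointDecay.SubcritBallAverageDecay (stmt-CriticalPhenomena-0835) with a = 3 − α (support
CatalystToSubcritBallDecay). [difficulty: open-problem] -/
@[route_item "route-CriticalPhenomena-PercLongRangeCatalyst"]
def UniformCatalystTwoPoint : Prop :=
  ∃ α C : ℝ, 0 < α ∧ α < 3 ∧ ∀ l : ℝ, 0 < l → l ≤ 1 → ∀ b : ℝ, 0 < b → (Literature.Probability.LatticeModels.prodBernoulli (fun e : Sym2 (Literature.Probability.LatticeModels.Site 3) => Set.projIcc (0:ℝ) 1 zero_le_one (1 - Real.exp (-(b * ((if e ∈ (Literature.Probability.LatticeModels.zdGraph 3).edgeSet then (1:ℝ) else 0) + l * (Sym2.lift ⟨fun x y : Literature.Probability.LatticeModels.Site 3 => (dist x y : ℝ), fun x y => dist_comm x y⟩ e) ^ (-(3 + α)))))))).real (Literature.Probability.Percolation.percolatesAt (0 : Literature.Probability.LatticeModels.Site 3)) = 0 → ∀ r : ℕ, 1 ≤ r → ∑ x ∈ Literature.Probability.LatticeModels.box 3 r, (Literature.Probability.LatticeModels.prodBernoulli (fun e : Sym2 (Literature.Probability.LatticeModels.Site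 3) => Set.projIcc (0:ℝ) 1 zero_le_one (1 - Real.exp (-(b * ((if e ∈ (Literature.Probability.LatticeModels.zdGraph 3).edgeSet then (1:ℝ) else 0) + l * (Sym2.lift ⟨fun x y : Literature.Probability.LatticeModels.Site 3 => (dist x y : ℝ), fun x y => dist_comm x y⟩ e) ^ (-(3 + α)))))))).real (Literature.Probability.Percolation.openConn (0 : Literature.Probability.LatticeModels.Site 3) x) ≤ C * (r : ℝ) ^ α

/-- item stmt-CriticalPhenomena-4824 · support · rank 9 · closed · proved by Summit.CriticalPhenomena.PercolationContinuityZ3.Theorems.SubcritCatalystStability.subcritCatalystStability_proof @ fa9c3758be87 (prover) · by planner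
sources: AizenmanNewman1984, AizenmanBarsky1987, DuminilCopinTassionCMP2016, vandenBergKestenJAP1985, GrimmettPercolation1999
[support] removal of the catalyst is free below p_c: for every α > 0 and every p < p_c(ℤ³) there are
b > 0 and λ ∈ (0,1] with p ≤ 1 − e^{−b} (so n.n.-p is dominated edgewise by the catalyst model,
whose n.n. edges have weight 1 − e^{−b(1+λ)}) and P_{b,λ}(|K(0)| = ∞) = 0. Proof sketch
(Aizenman–Newman cluster-of-clusters / BK): χ_{b,λ} ≤ Σ_k χ_nn(p')^{k+1}(bλK_α)^k < ∞ once bλK_α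
χ_nn(p') < 1, where p' = 1 − e^{−b(1+λ)} < p_c for λ small, K_α = Σ_{y≠0}‖y‖_∞^{−3−α} < ∞, χ_nn(p')
< ∞ by sharpness (SharpnessDCT / AizenmanBarsky1987); χ < ∞ ⇒ θ = 0. Needs BK
(vandenBergKestenJAP1985; BKFinitary.lean) for prodBernoulli on a countable edge set via
finite-volume approximation. [difficulty: M] -/
@[route_item "route-CriticalPhenomena-PercLongRangeCatalyst"]
def SubcritCatalystStability : Prop :=
  ∀ α : ℝ, 0 < α → ∀ p : unitInterval, (p : ℝ) < Literature.Probability.Percolation.criticalProb (Literature.Probability.LatticeModels.zdGraph 3) (0 : Literature.Probability.LatticeModels.Site 3) → ∃ b l : ℝ, 0 < b ∧ 0 < l ∧ l ≤ 1 ∧ (p : ℝ) ≤ 1 - Real.exp (-b) ∧ (Literature.Probability.LatticeModels.prodBernoulli (fun e : Sym2 (Literature.Probability.LatticeModels.Site 3) => Set.projIcc (0:ℝ) 1 zero_le_one (1 - Real.exp (-(b * ((if e ∈ (Literature.Probability.LatticeModels.zdGraph 3).edgeSet then (1:ℝ) else 0) + l * (Sym2.lift ⟨fun x y : Literature.Probability.LatticeModels.Site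 3 => (dist x y : ℝ), fun x y => dist_comm x y⟩ e) ^ (-(3 + α)))))))).real (Literature.Probability.Percolation.percolatesAt (0 : Literature.Probability.LatticeModels.Site 3)) = 0

-- `SubcritCatalystStability` holds: proved by `Summit.CriticalPhenomena.PercolationContinuityZ3.Theorems.SubcritCatalystStability.subcritCatalystStability_proof` @ fa9c3758be87 (its module imports this route file, so no `_holds` link can be stated here).

/-- item stmt-CriticalPhenomena-4825 · support · rank 9 · closed · proved by Summit.CriticalPhenomena.PercolationContinuityZ3.Theorems.CatalystBridge.catalystToSubcritBallDecay_proof @ 21dfc9435651 (prover) · by planner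
sources: GrimmettPercolation1999, Hutchcroft2022
[support] bridge to route PercTwoPointDecay: UniformCatalystTwoPoint → SubcritCatalystStability →
SubcritBallAverageDecay (the signature of stmt-CriticalPhenomena-0835, with a = 3 − α): for p < p_c
pick (b,λ) from S, compare edge weights (on n.n. edges 1 − e^{−b(1+λ)} ≥ 1 − e^{−b} ≥ p, elsewhere ≥
0; bondPercolation = prodBernoulli of the indicator weights, prodBernoulli_indicator_holds) and
apply prodBernoulli_real_mono_of_isUpperSet to the increasing events {0 ↔ x}; R^α = R^{3−(3−α)}.
[difficulty: provable-now] -/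
@[route_item "route-CriticalPhenomena-PercLongRangeCatalyst"]
def CatalystToSubcritBallDecay : Prop :=
  UniformCatalystTwoPoint → SubcritCatalystStability → (∃ a C : ℝ, 0 < a ∧ ∀ p : unitInterval, (p : ℝ) < Literature.Probability.Percolation.criticalProb (Literature.Probability.LatticeModels.zdGraph 3) 0 → ∀ R : ℕ, 1 ≤ R → ∑ x ∈ Literature.Probability.LatticeModels.box 3 R, (Literature.Probability.Percolation.bondPercolation (Literature.Probability.LatticeModels.zdGraph 3) p).real (Literature.Probability.Percolation.openConn 0 x) ≤ C * (R : ℝ) ^ (3 - a))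

-- `CatalystToSubcritBallDecay` holds: proved by `Summit.CriticalPhenomena.PercolationContinuityZ3.Theorems.CatalystBridge.catalystToSubcritBallDecay_proof` @ 21dfc9435651 (its module imports this route file, so no `_holds` link can be stated here).

/-- item stmt-CriticalPhenomena-4826 · assembly · rank 1 · closed · proved by Summit.CriticalPhenomena.PercolationContinuityZ3.Theorems.PercLongRangeCatalystAssembly.assembly_proof @ 5aefe60a5ebd (prover) · by planner
sources: GrimmettPercolation1999, Hutchcroft2022
[assembly] UniformCatalystVolumeTail → SubcritCatalystStability → PercolationContinuityZ3. -/
@[route_item "route-CriticalPhenomena-PercLongRangeCatalyst"]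
def Assembly : Prop :=
  UniformCatalystVolumeTail → SubcritCatalystStability → PercolationContinuityZ3

-- `Assembly` holds: proved by `Summit.CriticalPhenomena.PercolationContinuityZ3.Theorems.PercLongRangeCatalystAssembly.assembly_proof` @ 5aefe60a5ebd (its module imports this route file, so no `_holds` link can be stated here).

/-! D-0027 §2.1 — DECIDING THEOREM (planner-authored via `route open/edit --closes-file`; by planner-rbadge-CriticalPhenomena-PercLongRange-3094749d-g4-0 2026-08-15T16:13:50Z):
its hypotheses are this route's items and its conclusion the sub-problem Statement (glue_lint), and it elaborates with this file. -/

@[closes "route-CriticalPhenomena-PercLongRangeCatalyst"] theorem closes : UniformCatalystVolumeTail → SubcritCatalystStability → Assembly → _root_.PercolationContinuityZ3 :=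
  fun hU hS hA => hA hU hS

end Summit.CriticalPhenomena.PercolationContinuityZ3.Theses.PercLongRangeCatalyst
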